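import Mathlib
import HarnessLib
import Literature.MathematicalPhysics.StatisticalMechanics.MuGSC
import Literature.MathematicalPhysics.StatisticalMechanics.LennardJonesClusters

/-!
# OverbindingBudget — bookkeeping stubs of the `CubeChargeLaw` line (stmt-AtomisticToContinuum-30251)

Three of the four registered stubs of the line «Bookkeeping» for the support item
`Summit.AtomisticToContinuum.Crystallization.Theses.OverbindingBudget.CubeChargeLaw` (skeleton
`Cruxes/CubeChargeLaw/Lines/birth.lean`, composition `CubeChargeLaw_of`), proved by name with their registered
signatures:

* `stub_siteSumSplit` — a Lennard-Jones site sum over a uniformly discrete `Y` splits into the finite part over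
  `F ⊆ Y` and the tail over `Y ∖ F` (`Summable.tsum_union_disjoint`, `Finset.tsum_subtype'`);
* `stub_pairSumLowerBound` — the full double sum over `F × F` (diagonal `V_LJ(0) = 0`) is twice the interaction
  energy of the canonical enumeration of `F`, hence `≥ 2 E(#F) ≥ 2e·#F` when `e ≤ E(N)/N` for all `N > 0`
  (`two_mul_interactionEnergy_eq_sum_sum`, `groundStateEnergy_lennardJones_le`);
* `stub_removalUpperBound` — the μ-stability REMOVAL test `U(F) + I(F, Y ∖ F) ≤ e·#F` (`IsMuGSC.removal`) in
  double-sum / site-sum form.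

The remaining stub `stub_crossTermSmall` (cross field `o(ℓ³)`) is the line's hardest; its tail input is
`tsum_abs_lennardJones_le_of_far` (promotion to Literature requested).
-/

namespace Summit.AtomisticToContinuum.Crystallization.Theorems.OverbindingBudgetCubeBookkeeping

open Literature.MathematicalPhysics.StatisticalMechanics

/-- The canonical enumeration of a Finset has range the Finset. [folklore] -/
theorem range_equivFin_symm_val (F : Finset (EuclideanSpace ℝ (Fin 3))) :
    Set.range (fun i : Fin F.card => ((F.equivFin.symm i : F) : EuclideanSpace ℝ (Fin 3))) = ↑F := by
  ext z
  constructor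
  · rintro ⟨i, rfl⟩
    exact (F.equivFin.symm i).2
  · intro hz
    exact ⟨F.equivFin ⟨z, hz⟩, by simp⟩

/-- A sum over the canonical enumeration is the sum over the Finset. [folklore] -/
theorem sum_equivFin_symm (F : Finset (EuclideanSpace ℝ (Fin 3))) (g : EuclideanSpace ℝ (Fin 3) → ℝ) :
    ∑ i : Fin F.card, g ((F.equivFin.symm i : F) : EuclideanSpace ℝ (Fin 3)) = ∑ z ∈ F, g z := by
  rw [Fintype.sum_equiv F.equivFin.symm (fun i => g ((F.equivFin.symm i : F) : EuclideanSpace ℝ (Fin 3)))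
    (fun c => g (c : EuclideanSpace ℝ (Fin 3))) (fun _ => rfl)]
  exact Finset.sum_coe_sort F g

/-- Twice the Lennard-Jones interaction energy of the canonical enumeration of `F` is the full double sum over
`F × F` (diagonal `V_LJ(0) = 0`). [folklore] -/
theorem two_mul_interactionEnergy_enum (F : Finset (EuclideanSpace ℝ (Fin 3))) :
    2 * interactionEnergy lennardJones (fun i : Fin F.card => ((F.equivFin.symm i : F) : EuclideanSpace ℝ (Fin 3))) =
      ∑ y ∈ F, ∑ w ∈ F, lennardJones (dist y w) := by
  rw [two_mul_interactionEnergy_eq_sum_sum lennardJones lennardJones_zero]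
  have inner : ∀ x : EuclideanSpace ℝ (Fin 3),
      ∑ k : Fin F.card, lennardJones (dist x ((F.equivFin.symm k : F) : EuclideanSpace ℝ (Fin 3))) =
        ∑ z ∈ F, lennardJones (dist x z) :=
    fun x => sum_equivFin_symm F (fun z => lennardJones (dist x z))
  simp_rw [inner]
  exact sum_equivFin_symm F (fun x => ∑ z ∈ F, lennardJones (dist x z))

/-- Registered stub `stub_siteSumSplit` of the line «Bookkeeping» (CubeChargeLaw, stmt-30251). [folklore] -/
theorem stub_siteSumSplit : ∀ Y : Set (EuclideanSpace ℝ (Fin 3)), Literature.MathematicalPhysics.StatisticalMechanics.UniformlyDiscrete Y → ∀ F : Finset (EuclideanSpace ℝ (Fin 3)), (↑F : Set (EuclideanSpace ℝ (Fin 3))) ⊆ Y → ∀ y : EuclideanSpace ℝ (Fin 3), (∑' w : ↥Y, Literature.MathematicalPhysics.StatisticalMechanics.lennardJones (dist y (w : EuclideanSpace ℝ (Fin 3)))) = (∑ w ∈ F, Literature.MathematicalPhysics.StatisticalMechanics.lennardJones (dist y w)) + ∑' w : ↥(Y \ ↑F), Literature.MathematicalPhysics.StatisticalMechanics.lennardJones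 (dist y (w : EuclideanSpace ℝ (Fin 3))) := by
  intro Y hUD F hFY y
  classical
  have hY : (↑F : Set (EuclideanSpace ℝ (Fin 3))) ∪ (Y \ ↑F) = Y := Set.union_sdiff_cancel hFY
  have hdisj : Disjoint (↑F : Set (EuclideanSpace ℝ (Fin 3))) (Y \ ↑F) := Set.disjoint_sdiff_right
  have hsF : Summable ((fun w : EuclideanSpace ℝ (Fin 3) => lennardJones (dist y w)) ∘ (↑) :
      (↑F : Set (EuclideanSpace ℝ (Fin 3))) → ℝ) := Summable.of_finite
  have hsT : Summable ((fun w : EuclideanSpace ℝ (Fin 3) => lennardJones (dist y w)) ∘ (↑) :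
      (Y \ ↑F : Set (EuclideanSpace ℝ (Fin 3))) → ℝ) :=
    (hUD.mono Set.sdiff_subset).summable_lennardJones y
  have h1 := tsum_congr_set_coe (fun w : EuclideanSpace ℝ (Fin 3) => lennardJones (dist y w)) hY
  have h2 := hsF.tsum_union_disjoint hdisj hsT
  have h3 := Finset.tsum_subtype' F (fun w : EuclideanSpace ℝ (Fin 3) => lennardJones (dist y w))
  rw [← h1, h2, h3]

/-- Registered stub `stub_pairSumLowerBound` of the line «Bookkeeping» (CubeChargeLaw, stmt-30251). [folklore] -/
theorem stub_pairSumLowerBound : ∀ e : ℝ, (∀ N : ℕ, 0 < N → e ≤ Literature.MathematicalPhysics.StatisticalMechanics.groundStateEnergy Literature.MathematicalPhysics.StatisticalMechanics.lennardJones 3 N / N) → ∀ F : Finset (EuclideanSpace ℝ (Fin 3)), 2 * e * (F.card : ℝ) ≤ ∑ y ∈ F, ∑ w ∈ F, Literature.MathematicalPhysics.StatisticalMechanics.lennardJones (dist y w) := by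
  intro e he F
  classical
  rcases Nat.eq_zero_or_pos F.card with h0 | hpos
  · rw [Finset.card_eq_zero.1 h0]
    simp
  have hE := groundStateEnergy_lennardJones_le
    (fun _ _ h => F.equivFin.symm.injective (Subtype.ext h) :
    Function.Injective (fun i : Fin F.card => ((F.equivFin.symm i : F) : EuclideanSpace ℝ (Fin 3))))
  have hen : e ≤ groundStateEnergy lennardJones 3 F.card / F.card := he _ hpos
  have hn : (0 : ℝ) < F.card := by exact_mod_cast hpos
  rw [le_div_iff₀ hn] at hen
  have hD := two_mul_interactionEnergy_enum F
  linarith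

/-- Registered stub `stub_removalUpperBound` of the line «Bookkeeping» (CubeChargeLaw, stmt-30251): the μ-stability
removal test in double-sum form. [cite: Suto2006, §2 Definition (μGSC), second form] -/
theorem stub_removalUpperBound : ∀ e : ℝ, ∀ Y : Set (EuclideanSpace ℝ (Fin 3)), Literature.MathematicalPhysics.StatisticalMechanics.UniformlyDiscrete Y → Literature.MathematicalPhysics.StatisticalMechanics.IsMuGSC Literature.MathematicalPhysics.StatisticalMechanics.lennardJones e Y → ∀ F : Finset (EuclideanSpace ℝ (Fin 3)), (↑F : Set (EuclideanSpace ℝ (Fin 3))) ⊆ Y → 1 / 2 * (∑ y ∈ F, ∑ w ∈ F, Literature.MathematicalPhysics.StatisticalMechanics.lennardJones (dist y w)) + ∑ y ∈ F, ∑' w : ↥(Y \ ↑F), Literature.MathematicalPhysics.StatisticalMechanics.lennardJones (dist y (w : EuclideanSpace ℝ (Fin 3))) ≤ e * (F.card : ℝ) := by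
  intro e Y hUD hμ F hFY
  classical
  have hinj :
      Function.Injective (fun i : Fin F.card => ((F.equivFin.symm i : F) : EuclideanSpace ℝ (Fin 3))) :=
    fun _ _ h => F.equivFin.symm.injective (Subtype.ext h)
  have hrange := range_equivFin_symm_val F
  have hsub : Set.range (fun i : Fin F.card => ((F.equivFin.symm i : F) : EuclideanSpace ℝ (Fin 3))) ⊆ Y := by
    rw [hrange]; exact hFY
  have hrem := hμ.removal hinj hsub
  rw [hrange, fieldEnergy_eq] at hrem
  have hD := two_mul_interactionEnergy_enum F
  have hF : ∑ i : Fin F.card, ∑' w : ↥(Y \ ↑F),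
      lennardJones (dist ((F.equivFin.symm i : F) : EuclideanSpace ℝ (Fin 3)) (w : EuclideanSpace ℝ (Fin 3))) =
      ∑ y ∈ F, ∑' w : ↥(Y \ ↑F), lennardJones (dist y (w : EuclideanSpace ℝ (Fin 3))) :=
    sum_equivFin_symm F (fun y => ∑' w : ↥(Y \ ↑F), lennardJones (dist y (w : EuclideanSpace ℝ (Fin 3))))
  rw [hF] at hrem
  linarith

end Summit.AtomisticToContinuum.Crystallization.Theorems.OverbindingBudgetCubeBookkeeping
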